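import Summits.NavierStokesRegularity.NavierStokesRegularity.Theorems.PerpetualPumpPumpTransferMildOfBandField
import Summits.NavierStokesRegularity.NavierStokesRegularity.Theorems.PerpetualPumpPumpTransferBandFieldExists
import Literature.Analysis.FluidPDE.TaoCascadeVolterraEstimates
import Literature.Analysis.FluidPDE.TaoCascadeEquationsOfMotion
import Mathlib.MeasureTheory.Integral.DominatedConvergence
import Mathlib.Topology.MetricSpace.Contracting
import Mathlib.Topology.ContinuousMap.Bounded.Normed
import HarnessLib

/-!
# `PerpetualPump.PumpTransfer` (stmt-NavierStokesRegularity-1837), line `Sketch`: local theory of the lifted Volterra system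

Helper file (theorems only) for the registered stub `stub_volterra_maximal` of the lead's skeleton
`Cruxes/PumpTransfer/Lines/Sketch.lean` (lead prover prover-line-stmt-NavierStokesRegularity-1837-0); it proves the
registered sub-goal `stub_volterra_local` (one Picard step with history), the gluing of local solutions and the energy
bound of a solution.

The LIFTED VOLTERRA SYSTEM of Tao's cascade equation (3.3) (Lemma 4.1 read mode by mode) has unknowns
`X : Fin m → ℤ → ℝ → ℝ` and reads `X_{i,n}(t) = 𝒱[X]_{i,n}(t) := ∫ φ[X]_{i,n}(ξ,t) |ψ̂_{i,n}(ξ)|² dξ`, where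
`φ[X]_{i,n}(ξ,t) = duhamelScalar δ_{i,n} Q[X]_{i,n} (4π²|ξ|²) t` is the heat fibre with datum `δ_{i,n} = A·1_{(i,n)=(i₀,n₀)}`
driven by `Q[X]_{i,n}(s) = quadTerm_{i,n}(X(max(s,0)))`. Everything happens in the weighted space
`‖X‖_W = sup_{i,n} w_n |X_{i,n}|`, `w_n = 1 + (1+ε₀)^{10n}`; the self-map and contraction estimates of `𝒱` on `W`-balls
and uniqueness are `volterra_abs_le`, `volterra_sub_le`, `volterra_unique`
(`Literature/Analysis/FluidPDE/TaoCascadeVolterraEstimates.lean`).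

* **`stub_volterra_local`**: given a solution on `[0,T]` with `W`-bound `B`, Banach's fixed point theorem in the closed
  history set `{Z : ‖Z‖ ≤ R, Z = w·Xo on [0,T]}` of the bounded continuous functions on `(Fin m × ℤ) × [0,T+τ]`
  produces a solution on `[0,T+τ]` with `W`-bound `R`, for explicit `R(B,T,A)` and `τ(R)`;
* `volterra_glue`, `continuousOn_glue`: solutions on the intervals `[0,σ(s)]`, `s ∈ I`, agree on overlaps (uniqueness)
  and glue to a solution on `I` with the local bounds, continuous on `I` when `I` has no largest element;
* `abs_le_of_sol` — **the energy bound `|X_{i,n}(t)| ≤ |A|`** for a solution on `[0,T]`, `t < T`: by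
  `X̃² ≤ Ẽ ≤ δ² + 2∫₀ᵗ Q X` (`TaoCascadeDuhamelRestart`) summed over finitely many modes, and the flux series
  `∑_p ∫₀ᵗ Q_p X_p = ∫₀ᵗ ∑_p Q_p X_p = 0`: the mode sum vanishes pointwise because it is `⟨C(u,u),u⟩ = 0`
  (`cascadeOperatorForm_cancel`) for the band field `u(s)` of the landed `stub_bandField_exists`, whose coefficients
  are the `X_{j,k}(s)` (`stub_modeCoeff_of_bandField`, `cascadeOperatorForm_eq_tsum_quadTerm`); dominated interchange
  by the summable mode bounds `b_n` (`summable_fibreBound`).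

## References

* T. Tao, J. Amer. Math. Soc. 29 (2016), 601–674 = arXiv:1402.0290v3, §4 Lemma 4.1 (4.14). [`Tao2016AveragedNS`]
-/

noncomputable section

-- the nested summit namespace is the tree's layout (D-0017)
set_option linter.dupNamespace false

namespace Summit.NavierStokesRegularity.NavierStokesRegularity.Theorems.PerpetualPumpPumpTransfer

open MeasureTheory Set Filter Topology Function
open scoped ENNReal NNReal SchwartzMap BoundedContinuousFunction
open Literature.Analysis Literature.Analysis.FluidPDE Literature.Analysis.FluidPDE.Tao2016

variable {ε₀ : ℝ} {m : ℕ}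

/-! ### One Picard step: the registered sub-goal `stub_volterra_local` -/

-- a long fixed-point construction with many arithmetic side goals: the default heartbeat budget is too small
set_option maxHeartbeats 800000 in
/-- **Registered sub-goal `stub_volterra_local`: one Picard step (local existence with history).** Let `Xo` be continuous, solve the lifted Volterra system on
`[0,T]` (`T ≥ 0`) and obey `w_n|Xo_{i,n}| ≤ B` there. Put `K_α = ∑|α|`. If `B + w_{n₀}|A| + 2²²K_α T B² + 1 ≤ R`, `0 < τ`
and `τ · 2²³K_α R² ≤ 1`, there is a continuous `X` solving the system on `[0,T+τ]` with `w_n|X_{i,n}| ≤ R` there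
(Banach fixed point in the history set `{Z : ‖Z‖ ≤ R, Z = w·Xo on [0,T]}` of the bounded continuous functions on
`(Fin m × ℤ) × [0,T+τ]`; `volterra_abs_le` gives the self-map, `volterra_sub_le` the contraction by `1/2`). [cite: Tao2016AveragedNS, §4 Lemma 4.1 (4.14)] -/
theorem stub_volterra_local :
    ∀ (ε₀ : ℝ), 0 < ε₀ → ε₀ < 1 → ∀ (m : ℕ) (𝒟 : CascadeWaveletData ε₀ m)
    (α : Fin m → Fin m → Fin m → ℤ × ℤ × ℤ → ℝ) (i₀ : Fin m) (n₀ : ℤ) (A T B R τ : ℝ) (Xo : Fin m → ℤ → ℝ → ℝ),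
    0 ≤ T → (∀ (i : Fin m) (n : ℤ), Continuous (Xo i n)) →
    (∀ (i : Fin m) (n : ℤ), ∀ t ∈ Icc (0 : ℝ) T, Xo i n t = ∫ ξ : EuclideanSpace ℝ (Fin 3),
      duhamelScalar (A * modeDelta i₀ i n₀ n) (fun s => TaoCascade.quadTerm ε₀ α Xo i n (max s 0)) (heatRate ξ) t *
        modeWeight 𝒟 i n ξ) →
    (∀ (i : Fin m) (n : ℤ), ∀ t ∈ Icc (0 : ℝ) T, (1 + ((1 + ε₀) ^ n) ^ 10) * |Xo i n t| ≤ B) →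
    B + (1 + ((1 + ε₀) ^ n₀) ^ 10) * |A| +
      2 ^ 22 * (∑ i₃ : Fin m, ∑ i₁ : Fin m, ∑ i₂ : Fin m, ∑ μ ∈ TaoCascade.shiftSet, |α i₁ i₂ i₃ μ|) * T * B ^ 2 + 1 ≤ R →
    0 < τ → τ * (2 ^ 23 * (∑ i₃ : Fin m, ∑ i₁ : Fin m, ∑ i₂ : Fin m, ∑ μ ∈ TaoCascade.shiftSet, |α i₁ i₂ i₃ μ|) * R ^ 2) ≤ 1 →
    ∃ X : Fin m → ℤ → ℝ → ℝ, (∀ (i : Fin m) (n : ℤ), Continuous (X i n)) ∧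
      (∀ (i : Fin m) (n : ℤ), ∀ t ∈ Icc (0 : ℝ) (T + τ), X i n t = ∫ ξ : EuclideanSpace ℝ (Fin 3),
        duhamelScalar (A * modeDelta i₀ i n₀ n) (fun s => TaoCascade.quadTerm ε₀ α X i n (max s 0)) (heatRate ξ) t *
          modeWeight 𝒟 i n ξ) ∧
      ∀ (i : Fin m) (n : ℤ), ∀ t ∈ Icc (0 : ℝ) (T + τ), (1 + ((1 + ε₀) ^ n) ^ 10) * |X i n t| ≤ R := by
  intro ε₀ hε₀ hε₁ m 𝒟 α i₀ n₀ A T B R τ Xo hT hXc hV hXB hR hτ hτR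
  set K : ℝ := ∑ i₃ : Fin m, ∑ i₁ : Fin m, ∑ i₂ : Fin m, ∑ μ ∈ TaoCascade.shiftSet, |α i₁ i₂ i₃ μ| with hK
  have hε : 0 < 1 + ε₀ := by linarith
  have hw0 : ∀ k : ℤ, 0 < 1 + ((1 + ε₀) ^ k) ^ 10 := fun k => by positivity
  have hB0 : 0 ≤ B := le_trans (by positivity) (hXB i₀ n₀ 0 ⟨le_rfl, hT⟩)
  have hK0 : 0 ≤ K := by positivity
  have hR1 : 1 ≤ R := by nlinarith [abs_nonneg A, hw0 n₀, mul_nonneg (mul_nonneg hK0 hT) (sq_nonneg B)]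
  have hBR : B ≤ R := by nlinarith [abs_nonneg A, hw0 n₀, mul_nonneg (mul_nonneg hK0 hT) (sq_nonneg B)]
  have hT' : (0 : ℝ) ≤ T + τ := by linarith
  have hTT' : T ≤ T + τ := by linarith
  -- coefficient families attached to bounded continuous functions on `(Fin m × ℤ) × [0,T+τ]`
  set toX : ((Fin m × ℤ) × Icc (0 : ℝ) (T + τ) →ᵇ ℝ) → Fin m → ℤ → ℝ → ℝ :=
    fun Z j k s => Z ((j, k), projIcc 0 (T + τ) hT' s) / (1 + ((1 + ε₀) ^ k) ^ 10) with htoX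
  have htoXc : ∀ Z (j : Fin m) (k : ℤ), Continuous (toX Z j k) := fun Z j k =>
    (Z.continuous.comp (continuous_const.prodMk continuous_projIcc)).div_const _
  have htoX_of_mem : ∀ Z (j : Fin m) (k : ℤ) {s : ℝ} (hs : s ∈ Icc (0 : ℝ) (T + τ)),
      toX Z j k s = Z ((j, k), ⟨s, hs⟩) / (1 + ((1 + ε₀) ^ k) ^ 10) := by
    intro Z j k s hs
    simp only [htoX, projIcc_of_mem hT' hs]
  have htoX_bound : ∀ Z (j : Fin m) (k : ℤ), ∀ s ∈ Icc (0 : ℝ) (T + τ), (1 + ((1 + ε₀) ^ k) ^ 10) * |toX Z j k s| ≤ ‖Z‖ := by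
    intro Z j k s hs
    rw [htoX_of_mem Z j k hs, abs_div, abs_of_pos (hw0 k), mul_div_cancel₀ _ (hw0 k).ne', ← Real.norm_eq_abs]
    exact Z.norm_coe_le_norm _
  -- the history set
  set S : Set ((Fin m × ℤ) × Icc (0 : ℝ) (T + τ) →ᵇ ℝ) := {Z | ‖Z‖ ≤ R ∧
    ∀ (p : Fin m × ℤ) (s : Icc (0 : ℝ) (T + τ)), (s : ℝ) ≤ T → Z (p, s) = (1 + ((1 + ε₀) ^ p.2) ^ 10) * Xo p.1 p.2 s}
    with hS
  have hhist : ∀ Z ∈ S, ∀ (j : Fin m) (k : ℤ), ∀ s ∈ Icc (0 : ℝ) T, toX Z j k s = Xo j k s := by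
    intro Z hZ j k s hs
    have hs' : s ∈ Icc (0 : ℝ) (T + τ) := ⟨hs.1, hs.2.trans hTT'⟩
    rw [htoX_of_mem Z j k hs', hZ.2 (j, k) ⟨s, hs'⟩ hs.2, mul_div_cancel_left₀ _ (hw0 k).ne']
  have hSR : ∀ Z ∈ S, ∀ (j : Fin m) (k : ℤ), ∀ s ∈ Icc (0 : ℝ) (T + τ), (1 + ((1 + ε₀) ^ k) ^ 10) * |toX Z j k s| ≤ R :=
    fun Z hZ j k s hs => (htoX_bound Z j k s hs).trans hZ.1
  -- the Picard map
  have hΦc' : ∀ Z (p : Fin m × ℤ), Continuous fun x : Icc (0 : ℝ) (T + τ) => (1 + ((1 + ε₀) ^ p.2) ^ 10) *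
      ∫ ξ : EuclideanSpace ℝ (Fin 3), duhamelScalar (A * modeDelta i₀ p.1 n₀ p.2)
        (fun s => TaoCascade.quadTerm ε₀ α (toX Z) p.1 p.2 (max s 0)) (heatRate ξ) x * modeWeight 𝒟 p.1 p.2 ξ :=
    fun Z p => continuous_const.mul ((continuous_integral_duhamelScalar_modeWeight (𝒟 := 𝒟) (i := p.1) (n := p.2)
      (δ := A * modeDelta i₀ p.1 n₀ p.2) hε (continuous_quadTerm_clamp α (htoXc Z) p.1 p.2)).comp continuous_subtype_val)
  have hΦc : ∀ Z, Continuous fun q : (Fin m × ℤ) × Icc (0 : ℝ) (T + τ) => (1 + ((1 + ε₀) ^ q.1.2) ^ 10) *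
      ∫ ξ : EuclideanSpace ℝ (Fin 3), duhamelScalar (A * modeDelta i₀ q.1.1 n₀ q.1.2)
        (fun s => TaoCascade.quadTerm ε₀ α (toX Z) q.1.1 q.1.2 (max s 0)) (heatRate ξ) q.2 * modeWeight 𝒟 q.1.1 q.1.2 ξ :=
    fun Z => continuous_prod_of_discrete_left.2 fun p => hΦc' Z p
  have hΦb : ∀ Z (q : (Fin m × ℤ) × Icc (0 : ℝ) (T + τ)), ‖(1 + ((1 + ε₀) ^ q.1.2) ^ 10) *
      ∫ ξ : EuclideanSpace ℝ (Fin 3), duhamelScalar (A * modeDelta i₀ q.1.1 n₀ q.1.2)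
        (fun s => TaoCascade.quadTerm ε₀ α (toX Z) q.1.1 q.1.2 (max s 0)) (heatRate ξ) q.2 * modeWeight 𝒟 q.1.1 q.1.2 ξ‖ ≤
      (1 + ((1 + ε₀) ^ n₀) ^ 10) * |A| + 2 ^ 22 * K * (0 * ‖Z‖ ^ 2 + (T + τ - 0) * ‖Z‖ ^ 2) := by
    intro Z q
    rw [Real.norm_eq_abs, abs_mul, abs_of_pos (hw0 _)]
    exact volterra_abs_le hε₀ hε₁ 𝒟 α i₀ n₀ A (htoXc Z) le_rfl hT'
      (fun j k s hs => htoX_bound Z j k s ⟨hs.1, hs.2.trans hT'⟩) (htoX_bound Z) q.1.1 q.1.2 ⟨q.2.2.1, q.2.2.2⟩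
  set 𝒯 : ((Fin m × ℤ) × Icc (0 : ℝ) (T + τ) →ᵇ ℝ) → ((Fin m × ℤ) × Icc (0 : ℝ) (T + τ) →ᵇ ℝ) := fun Z =>
    BoundedContinuousFunction.ofNormedAddCommGroup _ (hΦc Z) _ (hΦb Z) with h𝒯
  have h𝒯_apply : ∀ Z (q : (Fin m × ℤ) × Icc (0 : ℝ) (T + τ)), 𝒯 Z q = (1 + ((1 + ε₀) ^ q.1.2) ^ 10) *
      ∫ ξ : EuclideanSpace ℝ (Fin 3), duhamelScalar (A * modeDelta i₀ q.1.1 n₀ q.1.2)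
        (fun s => TaoCascade.quadTerm ε₀ α (toX Z) q.1.1 q.1.2 (max s 0)) (heatRate ξ) q.2 * modeWeight 𝒟 q.1.1 q.1.2 ξ :=
    fun Z q => rfl
  -- on `[0,T]` the image of a history-respecting `Z` is the history
  have hkey : ∀ Z ∈ S, ∀ (p : Fin m × ℤ) (s : Icc (0 : ℝ) (T + τ)), (s : ℝ) ≤ T →
      𝒯 Z (p, s) = (1 + ((1 + ε₀) ^ p.2) ^ 10) * Xo p.1 p.2 s := by
    intro Z hZ p s hsT
    rw [h𝒯_apply, hV p.1 p.2 s ⟨s.2.1, hsT⟩]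
    congr 1
    refine integral_congr_ae (Eventually.of_forall fun ξ => ?_)
    simp only
    rw [duhamelScalar_congr s.2.1 fun r hr => quadTerm_congr α
      (fun j k => hhist Z hZ j k _ ⟨le_max_right _ _, max_le (hr.2.trans hsT) hT⟩) p.1 p.2]
  have hmaps : MapsTo 𝒯 S S := by
    intro Z hZ
    refine ⟨(BoundedContinuousFunction.norm_le (by linarith)).2 fun q => ?_, fun p s hs => hkey Z hZ p s hs⟩
    rcases le_or_gt (q.2 : ℝ) T with hqT | hqT
    · rw [show q = (q.1, q.2) from rfl, hkey Z hZ q.1 q.2 hqT, Real.norm_eq_abs, abs_mul, abs_of_pos (hw0 _)]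
      exact (hXB _ _ _ ⟨q.2.2.1, hqT⟩).trans hBR
    · rw [h𝒯_apply, Real.norm_eq_abs, abs_mul, abs_of_pos (hw0 _)]
      have h := volterra_abs_le hε₀ hε₁ 𝒟 α i₀ n₀ A (htoXc Z) hT hTT' (B := B) (R := R)
        (fun j k s hs => by rw [hhist Z hZ j k s hs]; exact hXB j k s hs) (hSR Z hZ) q.1.1 q.1.2 ⟨hqT.le, q.2.2.2⟩
      have h2 : 2 ^ 22 * K * (τ * R ^ 2) ≤ 1 := by nlinarith [hτR, hK0, sq_nonneg R, hτ.le]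
      nlinarith [h, hR, h2]
  have hlip : ∀ Z ∈ S, ∀ Z' ∈ S, dist (𝒯 Z) (𝒯 Z') ≤ 2⁻¹ * dist Z Z' := by
    intro Z hZ Z' hZ'
    refine (BoundedContinuousFunction.dist_le (by positivity)).2 fun q => ?_
    rcases le_or_gt (q.2 : ℝ) T with hqT | hqT
    · rw [show q = (q.1, q.2) from rfl, hkey Z hZ q.1 q.2 hqT, hkey Z' hZ' q.1 q.2 hqT, dist_self]
      positivity
    · rw [h𝒯_apply, h𝒯_apply, Real.dist_eq, ← mul_sub, abs_mul, abs_of_pos (hw0 _)]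
      have hDst : ∀ (j : Fin m) (k : ℤ), ∀ s ∈ Icc (0 : ℝ) (T + τ),
          (1 + ((1 + ε₀) ^ k) ^ 10) * |toX Z j k s - toX Z' j k s| ≤ dist Z Z' := by
        intro j k s hs
        rw [htoX_of_mem Z j k hs, htoX_of_mem Z' j k hs, ← sub_div, abs_div, abs_of_pos (hw0 k),
          mul_div_cancel₀ _ (hw0 k).ne', ← Real.dist_eq]
        exact Z.dist_coe_le_dist _
      have h := volterra_sub_le hε₀ hε₁ 𝒟 α (A * modeDelta i₀ q.1.1 n₀ q.1.2) (htoXc Z) (htoXc Z') hT hTT'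
        (hSR Z hZ) (hSR Z' hZ') hDst (fun j k s hs => by rw [hhist Z hZ j k s hs, hhist Z' hZ' j k s hs])
        q.1.1 q.1.2 ⟨hqT.le, q.2.2.2⟩
      have h2 : τ * (2 ^ 22 * K * R) ≤ 2⁻¹ := by nlinarith [hτR, hR1, hK0, hτ.le]
      calc _ ≤ (T + τ - T) * (2 ^ 22 * K * R * dist Z Z') := h
        _ = τ * (2 ^ 22 * K * R) * dist Z Z' := by ring
        _ ≤ 2⁻¹ * dist Z Z' := mul_le_mul_of_nonneg_right h2 dist_nonneg
  have hcontr : ContractingWith 2⁻¹ (hmaps.restrict 𝒯 S S) :=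
    ⟨inv_lt_one_of_one_lt₀ (by norm_num), LipschitzWith.of_dist_le_mul fun Z Z' => by
      rw [Subtype.dist_eq, Subtype.dist_eq, MapsTo.val_restrict_apply, MapsTo.val_restrict_apply, NNReal.coe_inv,
        NNReal.coe_ofNat]
      exact hlip Z Z.2 Z' Z'.2⟩
  -- the starting point: the history, frozen after `T`
  have hZ₀c' : ∀ p : Fin m × ℤ, Continuous fun x : Icc (0 : ℝ) (T + τ) =>
      (1 + ((1 + ε₀) ^ p.2) ^ 10) * Xo p.1 p.2 (min (x : ℝ) T) :=
    fun p => continuous_const.mul ((hXc p.1 p.2).comp (continuous_subtype_val.min continuous_const))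
  have hZ₀c : Continuous fun q : (Fin m × ℤ) × Icc (0 : ℝ) (T + τ) =>
      (1 + ((1 + ε₀) ^ q.1.2) ^ 10) * Xo q.1.1 q.1.2 (min (q.2 : ℝ) T) :=
    continuous_prod_of_discrete_left.2 fun p => hZ₀c' p
  have hZ₀b : ∀ q : (Fin m × ℤ) × Icc (0 : ℝ) (T + τ), ‖(1 + ((1 + ε₀) ^ q.1.2) ^ 10) * Xo q.1.1 q.1.2 (min (q.2 : ℝ) T)‖ ≤ B :=
    fun q => by
      rw [Real.norm_eq_abs, abs_mul, abs_of_pos (hw0 _)]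
      exact hXB _ _ _ ⟨le_min q.2.2.1 hT, min_le_right _ _⟩
  have hZ₀S : BoundedContinuousFunction.ofNormedAddCommGroup _ hZ₀c B hZ₀b ∈ S :=
    ⟨((BoundedContinuousFunction.norm_le hB0).2 hZ₀b).trans hBR, fun p s hs => by
      show (1 + ((1 + ε₀) ^ p.2) ^ 10) * Xo p.1 p.2 (min (s : ℝ) T) = _
      rw [min_eq_left hs]⟩
  have hSc : IsClosed S := by
    have h1 : IsClosed {Z : (Fin m × ℤ) × Icc (0 : ℝ) (T + τ) →ᵇ ℝ | ‖Z‖ ≤ R} := isClosed_le continuous_norm continuous_const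
    have h2 : IsClosed {Z : (Fin m × ℤ) × Icc (0 : ℝ) (T + τ) →ᵇ ℝ | ∀ (p : Fin m × ℤ) (s : Icc (0 : ℝ) (T + τ)),
        (s : ℝ) ≤ T → Z (p, s) = (1 + ((1 + ε₀) ^ p.2) ^ 10) * Xo p.1 p.2 s} := by
      simp only [setOf_forall]
      exact isClosed_iInter fun p => isClosed_iInter fun s => isClosed_iInter fun _ =>
        isClosed_eq (continuous_eval_const _) continuous_const
    exact h1.inter h2
  obtain ⟨Z, hZS, hfix, -⟩ := hcontr.exists_fixedPoint' hSc.isComplete hmaps hZ₀S (edist_ne_top _ _)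
  refine ⟨toX Z, htoXc Z, fun i n t ht => ?_, hSR Z hZS⟩
  have h := congr_arg (fun F : (Fin m × ℤ) × Icc (0 : ℝ) (T + τ) →ᵇ ℝ => F ((i, n), ⟨t, ht⟩)) hfix
  simp only [h𝒯_apply] at h
  rw [htoX_of_mem Z i n ht, ← h, mul_div_cancel_left₀ _ (hw0 n).ne']

/-! ### Gluing solutions along an exhaustion -/

/-- **Gluing.** Let `I` be down-closed in `[0,∞)` and `σ ≥ id` monotone on `I`; if for every `s ∈ I` the family
`Xf s` is a continuous solution on `[0,σ(s)]` with a weighted bound, then by uniqueness the solutions agree on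
overlaps, the diagonal `t ↦ Xf t (·,·) t` solves the system on `I`, and it is weighted-bounded on every `[0,S'] ⊆ I`. [cite: Tao2016AveragedNS, §4 Lemma 4.1 (4.14)] -/
theorem volterra_glue (hε₀ : 0 < ε₀) (hε₁ : ε₀ < 1) (𝒟 : CascadeWaveletData ε₀ m)
    (α : Fin m → Fin m → Fin m → ℤ × ℤ × ℤ → ℝ) (i₀ : Fin m) (n₀ : ℤ) (A : ℝ) {I : Set ℝ} {σ : ℝ → ℝ}
    {Xf : ℝ → Fin m → ℤ → ℝ → ℝ} (hI : ∀ s ∈ I, 0 ≤ s ∧ Icc 0 s ⊆ I)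
    (hσ : ∀ s ∈ I, s ≤ σ s ∧ ∀ s' ∈ I, s' ≤ s → σ s' ≤ σ s)
    (hc : ∀ s ∈ I, ∀ (i : Fin m) (n : ℤ), Continuous (Xf s i n))
    (hV : ∀ s ∈ I, ∀ (i : Fin m) (n : ℤ), ∀ t ∈ Icc (0 : ℝ) (σ s), Xf s i n t = ∫ ξ : EuclideanSpace ℝ (Fin 3),
      duhamelScalar (A * modeDelta i₀ i n₀ n) (fun r => TaoCascade.quadTerm ε₀ α (Xf s) i n (max r 0)) (heatRate ξ) t *
        modeWeight 𝒟 i n ξ)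
    (hB : ∀ s ∈ I, ∃ C : ℝ, ∀ (i : Fin m) (n : ℤ), ∀ t ∈ Icc (0 : ℝ) (σ s), (1 + ((1 + ε₀) ^ n) ^ 10) * |Xf s i n t| ≤ C) :
    (∀ s ∈ I, ∀ s' ∈ Icc (0 : ℝ) s, ∀ (i : Fin m) (n : ℤ), Xf s' i n s' = Xf s i n s') ∧
    (∀ (i : Fin m) (n : ℤ), ∀ t ∈ I, Xf t i n t = ∫ ξ : EuclideanSpace ℝ (Fin 3),
      duhamelScalar (A * modeDelta i₀ i n₀ n) (fun r => TaoCascade.quadTerm ε₀ α (fun j k r' => Xf r' j k r') i n (max r 0))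
        (heatRate ξ) t * modeWeight 𝒟 i n ξ) ∧
    (∀ S' ∈ I, ∃ C : ℝ, ∀ (i : Fin m) (n : ℤ), ∀ t ∈ Icc (0 : ℝ) S', (1 + ((1 + ε₀) ^ n) ^ 10) * |Xf t i n t| ≤ C) := by
  -- agreement on overlaps, by uniqueness on `[0, σ s']`
  have hagree : ∀ s ∈ I, ∀ s' ∈ Icc (0 : ℝ) s, ∀ (i : Fin m) (n : ℤ), Xf s' i n s' = Xf s i n s' := by
    intro s hs s' hs' i n
    have hs'I : s' ∈ I := (hI s hs).2 hs'
    have hσσ : σ s' ≤ σ s := (hσ s hs).2 s' hs'I hs'.2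
    obtain ⟨C₁, hC₁⟩ := hB s' hs'I
    obtain ⟨C₂, hC₂⟩ := hB s hs
    exact volterra_unique hε₀ hε₁ 𝒟 α i₀ n₀ A (T := σ s') (C := max C₁ C₂) (hc s' hs'I) (hc s hs) (hV s' hs'I)
      (fun j k t ht => hV s hs j k t ⟨ht.1, ht.2.trans hσσ⟩) (fun j k t ht => (hC₁ j k t ht).trans (le_max_left _ _))
      (fun j k t ht => (hC₂ j k t ⟨ht.1, ht.2.trans hσσ⟩).trans (le_max_right _ _)) i n s' ⟨hs'.1, (hσ s' hs'I).1⟩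
  refine ⟨hagree, fun i n t ht => ?_, fun S' hS' => ?_⟩
  · rw [hV t ht i n t ⟨(hI t ht).1, (hσ t ht).1⟩]
    refine integral_congr_ae (Eventually.of_forall fun ξ => ?_)
    simp only
    rw [duhamelScalar_congr (hI t ht).1 fun r hr => quadTerm_congr α (X := Xf t) (Y := fun j k r' => Xf r' j k r')
      (fun j k => (hagree t ht (max r 0) ⟨le_max_right _ _, max_le hr.2 (hI t ht).1⟩ j k).symm) i n]
  · obtain ⟨C, hC⟩ := hB S' hS'
    exact ⟨C, fun i n t ht => by rw [hagree S' hS' t ht i n]; exact hC i n t ⟨ht.1, ht.2.trans (hσ S' hS').1⟩⟩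

/-- The glued solution is continuous on `I` when `I` has no largest element (it is locally one of the `Xf s`). [folklore] -/
theorem continuousOn_glue {I : Set ℝ} {Xf : ℝ → Fin m → ℤ → ℝ → ℝ} (hI0 : ∀ s ∈ I, 0 ≤ s)
    (hopen : ∀ s ∈ I, ∃ s₁ ∈ I, s < s₁) (hc : ∀ s ∈ I, ∀ (i : Fin m) (n : ℤ), Continuous (Xf s i n))
    (hagree : ∀ s ∈ I, ∀ s' ∈ Icc (0 : ℝ) s, ∀ (i : Fin m) (n : ℤ), Xf s' i n s' = Xf s i n s') (i : Fin m) (n : ℤ) :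
    ContinuousOn (fun t => Xf t i n t) I := by
  intro t₀ ht₀
  obtain ⟨s₁, hs₁, hts₁⟩ := hopen t₀ ht₀
  have heq : (fun t => Xf t i n t) =ᶠ[𝓝[I] t₀] Xf s₁ i n := by
    filter_upwards [mem_nhdsWithin_of_mem_nhds (Iio_mem_nhds hts₁), self_mem_nhdsWithin] with t ht htI
    exact hagree s₁ hs₁ t ⟨hI0 t htI, le_of_lt ht⟩ i n
  exact ((hc s₁ hs₁ i n).continuousWithinAt.congr_of_eventuallyEq heq
    (hagree s₁ hs₁ t₀ ⟨hI0 t₀ ht₀, hts₁.le⟩ i n))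

/-- `1 + N¹⁰ ≤ (1 + N²)⁵` for the two weights of the statement. [folklore] -/
theorem weight_le_weight' {N : ℝ} : 1 + N ^ 10 ≤ (1 + N ^ 2) ^ 5 := by
  have h := one_add_pow_five_le (sq_nonneg N)
  calc 1 + N ^ 10 = 1 + (N ^ 2) ^ 5 := by ring
    _ ≤ (1 + N ^ 2) ^ 5 := h

/-! ### The energy bound of a solution -/

/-- **Energy bound.** For a continuous solution of the lifted Volterra system on `[0,T]` with a weighted bound and
cancelling structure constants, every coefficient obeys `|X_{i,n}(t)| ≤ |A|` for `t ∈ [0,T)`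
(`X_{i,n}² ≤ Ẽ_{i,n} ≤ ∑_{p ∈ F} Ẽ_p ≤ ∑_{p∈F} δ_p² + 2∑_{p∈F}∫₀ᵗ Q_pX_p → A² + 0` along the finite sets `F`). [cite: Tao2016AveragedNS, §4 Lemma 4.1 (4.11)–(4.12)] -/
theorem abs_le_of_sol (hε₀ : 0 < ε₀) (hε₁ : ε₀ < 1) (𝒟 : CascadeWaveletData ε₀ m)
    {α : Fin m → Fin m → Fin m → ℤ × ℤ × ℤ → ℝ} (hα : TaoCascade.IsCancellingCoeff α) (i₀ : Fin m) (n₀ : ℤ) (A : ℝ)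
    {T C : ℝ} {X : Fin m → ℤ → ℝ → ℝ} (hXc : ∀ (i : Fin m) (n : ℤ), Continuous (X i n))
    (hV : ∀ (i : Fin m) (n : ℤ), ∀ t ∈ Icc (0 : ℝ) T, X i n t = ∫ ξ : EuclideanSpace ℝ (Fin 3),
      duhamelScalar (A * modeDelta i₀ i n₀ n) (fun s => TaoCascade.quadTerm ε₀ α X i n (max s 0)) (heatRate ξ) t *
        modeWeight 𝒟 i n ξ)
    (hC : ∀ (i : Fin m) (n : ℤ), ∀ t ∈ Icc (0 : ℝ) T, (1 + ((1 + ε₀) ^ n) ^ 10) * |X i n t| ≤ C)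
    (i : Fin m) (n : ℤ) {t : ℝ} (ht : t ∈ Ico (0 : ℝ) T) : |X i n t| ≤ |A| := by
  have hε : 0 < 1 + ε₀ := by linarith
  set Q : Fin m × ℤ → ℝ → ℝ := fun p s => TaoCascade.quadTerm ε₀ α X p.1 p.2 (max s 0) with hQ
  have hQc : ∀ p, Continuous (Q p) := fun p => continuous_quadTerm_clamp α hXc p.1 p.2
  have htT : Icc (0 : ℝ) t ⊆ Icc (0 : ℝ) T := Icc_subset_Icc_right ht.2.le
  -- (1) the band field and its coefficients
  obtain ⟨u, hmem, -, hband⟩ := stub_bandField_exists ε₀ hε₀ hε₁ m 𝒟 α i₀ n₀ A T X hXc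
    fun S' hS' => ⟨C, fun i n t ht => hC i n t ⟨ht.1, ht.2.trans hS'.2.le⟩⟩
  have hcoef : ∀ s ∈ Ico (0 : ℝ) T, ∀ (j : Fin m) (k : ℤ), pairing (u s) (cascadeWavelet ε₀ (𝒟.ψ j) k) = (X j k s : ℂ) := by
    intro s hs j k
    have hre := stub_modeCoeff_of_bandField ε₀ hε₀ hε₁ m 𝒟 α i₀ n₀ A X s (u s) hXc hs.1 (hband s hs) j k
    rw [← hV j k s ⟨hs.1, hs.2.le⟩] at hre
    rw [eq_ofReal_re_of_im_eq_zero (pairing_im (hmem s hs).2.1 (isReal_cascadeWavelet ε₀ (𝒟.ψ j) k)), hre]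
  -- (2) the summable mode bounds of `Q_p X_p`
  set K : ℝ := (∑ i₃ : Fin m, ∑ i₁ : Fin m, ∑ i₂ : Fin m, ∑ μ ∈ TaoCascade.shiftSet, |α i₁ i₂ i₃ μ|) with hK
  set b : ℤ → ℝ := fun n => (((1 + ε₀) ^ n) ^ 2 + ((1 + ε₀) ^ n) ^ 3) / (1 + ((1 + ε₀) ^ n) ^ 10) ^ 2 with hb
  have hbsum : Summable fun p : Fin m × ℤ => b p.2 := summable_fibreBound (by linarith) m
  have hC0 : 0 ≤ C := le_trans (by positivity) (hC i n t ⟨ht.1, ht.2.le⟩)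
  have hQX : ∀ s ∈ Icc (0 : ℝ) T, ∀ p : Fin m × ℤ, |Q p s * X p.1 p.2 s| ≤ K * (2 ^ 10 * C) ^ 2 * C * b p.2 := by
    intro s hs p
    have h1 := abs_quadTerm_le hε₀ hε₁ α X (fun j k => hC j k s hs) p.1 p.2
    have hw1 : 1 ≤ 1 + ((1 + ε₀) ^ p.2) ^ 10 := le_add_of_nonneg_right (by positivity)
    have h2 : |X p.1 p.2 s| ≤ C := (le_mul_of_one_le_left (abs_nonneg _) hw1).trans (hC p.1 p.2 s hs)
    rw [abs_mul]
    simp only [hQ, max_eq_left hs.1]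
    calc |TaoCascade.quadTerm ε₀ α X p.1 p.2 s| * |X p.1 p.2 s|
        ≤ K * ((((1 + ε₀) ^ p.2) ^ 2 + ((1 + ε₀) ^ p.2) ^ 3) * (2 ^ 10 * C / (1 + ((1 + ε₀) ^ p.2) ^ 10)) ^ 2) * C :=
          mul_le_mul h1 h2 (abs_nonneg _) (by positivity)
      _ = K * (2 ^ 10 * C) ^ 2 * C * b p.2 := by
          simp only [hb, div_pow]
          ring
  -- (3) the mode sum of `Q_p X_p` vanishes: it is `⟨C(u,u), u⟩`
  have hcancel : ∀ s ∈ Ico (0 : ℝ) T, HasSum (fun p : Fin m × ℤ => Q p s * X p.1 p.2 s) 0 := by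
    intro s hs
    have h1 := cascadeOperatorForm_eq_tsum_quadTerm hε₀ hε₁ 𝒟 α X (fun j k => hC j k s ⟨hs.1, hs.2.le⟩) (hcoef s hs) (u s)
    rw [cascadeOperatorForm_cancel ε₀ 𝒟.ψ hα (u s)] at h1
    have hS : Summable fun p : Fin m × ℤ => ((Q p s * X p.1 p.2 s : ℝ) : ℂ) :=
      Summable.of_norm_bounded (hbsum.mul_left (K * (2 ^ 10 * C) ^ 2 * C)) fun p => by
        rw [Complex.norm_real, Real.norm_eq_abs]
        exact hQX s ⟨hs.1, hs.2.le⟩ p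
    have h2 : ∑' p : Fin m × ℤ, ((Q p s * X p.1 p.2 s : ℝ) : ℂ) = 0 := by
      rw [h1]
      refine tsum_congr fun p => ?_
      rw [hcoef s hs p.1 p.2]
      simp only [hQ, max_eq_left hs.1]
      push_cast
      ring
    have h3 := hS.hasSum
    rw [h2] at h3
    simpa using Complex.reCLM.hasSum h3
  -- (4) the flux series: `∑_p ∫₀ᵗ Q_p X_p = ∫₀ᵗ ∑_p Q_p X_p = 0`
  have hflux : HasSum (fun p : Fin m × ℤ => ∫ s in (0 : ℝ)..t, Q p s * X p.1 p.2 s) 0 := by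
    have hbd : ∀ p : Fin m × ℤ, ∀ᵐ s ∂volume, s ∈ uIoc (0 : ℝ) t → ‖Q p s * X p.1 p.2 s‖ ≤ K * (2 ^ 10 * C) ^ 2 * C * b p.2 :=
      fun p => Eventually.of_forall fun s hs => by
        rw [uIoc_of_le ht.1] at hs
        rw [Real.norm_eq_abs]
        exact hQX s ⟨hs.1.le, hs.2.trans ht.2.le⟩ p
    have hlim : ∀ᵐ s ∂volume, s ∈ uIoc (0 : ℝ) t → HasSum (fun p : Fin m × ℤ => Q p s * X p.1 p.2 s) 0 :=
      Eventually.of_forall fun s hs => by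
        rw [uIoc_of_le ht.1] at hs
        exact hcancel s ⟨hs.1.le, hs.2.trans_lt ht.2⟩
    have h := intervalIntegral.hasSum_integral_of_dominated_convergence (μ := volume) (a := 0) (b := t)
      (F := fun (p : Fin m × ℤ) s => Q p s * X p.1 p.2 s) (f := fun _ => (0 : ℝ))
      (fun p _ => K * (2 ^ 10 * C) ^ 2 * C * b p.2) (fun p => ((hQc p).mul (hXc p.1 p.2)).aestronglyMeasurable)
      hbd (Eventually.of_forall fun s _ => hbsum.mul_left _) intervalIntegrable_const hlim
    simpa using h
  -- (5) `X_p(t)² ≤ Ẽ_p(t) ≤ δ_p² + 2∫₀ᵗ Q_p X_p` for every mode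
  have hE : ∀ p : Fin m × ℤ, X p.1 p.2 t ^ 2 ≤ (A * modeDelta i₀ p.1 n₀ p.2) ^ 2 + 2 * ∫ s in (0 : ℝ)..t, Q p s * X p.1 p.2 s := by
    intro p
    have h1 := sq_integral_duhamelScalar_le (𝒟 := 𝒟) (i := p.1) (n := p.2) (δ := A * modeDelta i₀ p.1 n₀ p.2) hε (hQc p) t
    have h2 := integral_duhamelScalar_sq_le (𝒟 := 𝒟) (i := p.1) (n := p.2) (δ := A * modeDelta i₀ p.1 n₀ p.2) hε (hQc p) ht.1
    rw [← hV p.1 p.2 t ⟨ht.1, ht.2.le⟩] at h1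
    have h3 : (∫ s in (0 : ℝ)..t, Q p s * ∫ ξ : EuclideanSpace ℝ (Fin 3), duhamelScalar (A * modeDelta i₀ p.1 n₀ p.2) (Q p)
        (heatRate ξ) s * modeWeight 𝒟 p.1 p.2 ξ) = ∫ s in (0 : ℝ)..t, Q p s * X p.1 p.2 s :=
      intervalIntegral.integral_congr fun s hs => by
        rw [uIcc_of_le ht.1] at hs
        simp only [hQ]
        rw [← hV p.1 p.2 s (htT hs)]
    rw [h3] at h2
    exact h1.trans h2
  -- (6) sum over a finite set of modes containing `(i,n)` and pass to the limit along `hflux`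
  have hδ : ∀ p : Fin m × ℤ, (A * modeDelta i₀ p.1 n₀ p.2) ^ 2 = if (i₀, n₀) = p then A ^ 2 else 0 := by
    intro p
    unfold modeDelta
    by_cases h : i₀ = p.1 ∧ n₀ = p.2
    · rw [if_pos h, if_pos (Prod.ext h.1 h.2), mul_one]
    · rw [if_neg h, if_neg (fun h' => h ⟨(congrArg Prod.fst h' : _), (congrArg Prod.snd h' : _)⟩), mul_zero,
        zero_pow two_ne_zero]
  have hfin : ∀ F : Finset (Fin m × ℤ), (i, n) ∈ F →
      X i n t ^ 2 ≤ A ^ 2 + 2 * ∑ p ∈ F, ∫ s in (0 : ℝ)..t, Q p s * X p.1 p.2 s := by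
    intro F hF
    have h1 : X i n t ^ 2 ≤ ∑ p ∈ F, ((A * modeDelta i₀ p.1 n₀ p.2) ^ 2 + 2 * ∫ s in (0 : ℝ)..t, Q p s * X p.1 p.2 s) :=
      (hE (i, n)).trans (Finset.single_le_sum (f := fun p : Fin m × ℤ =>
        (A * modeDelta i₀ p.1 n₀ p.2) ^ 2 + 2 * ∫ s in (0 : ℝ)..t, Q p s * X p.1 p.2 s)
        (fun p _ => (sq_nonneg _).trans (hE p)) hF)
    have h2 : ∑ p ∈ F, (A * modeDelta i₀ p.1 n₀ p.2) ^ 2 ≤ A ^ 2 := by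
      simp only [hδ, Finset.sum_ite_eq]
      split_ifs
      · exact le_rfl
      · exact sq_nonneg A
    rw [Finset.sum_add_distrib, ← Finset.mul_sum] at h1
    linarith
  have hlim : Tendsto (fun F : Finset (Fin m × ℤ) => A ^ 2 + 2 * ∑ p ∈ F, ∫ s in (0 : ℝ)..t, Q p s * X p.1 p.2 s)
      atTop (𝓝 (A ^ 2 + 2 * 0)) := tendsto_const_nhds.add (hflux.const_mul 2)
  have hsq : X i n t ^ 2 ≤ A ^ 2 := by
    have h := ge_of_tendsto hlim (Filter.eventually_atTop.2 ⟨{(i, n)}, fun F hF =>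
      hfin F (Finset.singleton_subset_iff.1 hF)⟩)
    simpa using h
  exact sq_le_sq.1 hsq

end Summit.NavierStokesRegularity.NavierStokesRegularity.Theorems.PerpetualPumpPumpTransfer

end
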